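import Summits.ResolutionOfSingularities.ResolutionOfSingularities.Theorems.FrobeniusClosingPatchingRelPerfectDepthFlagLegalPhases
import Summits.ResolutionOfSingularities.ResolutionOfSingularities.Theorems.FrobeniusClosingPatchingRelPerfectDepthFlagLegalTargets
import Summits.ResolutionOfSingularities.ResolutionOfSingularities.Theorems.FrobeniusClosingPatchingRelPerfectDepthFlagDiagonal
import Summits.ResolutionOfSingularities.ResolutionOfSingularities.Theorems.FrobeniusClosingPatchingRelPerfectDepthFlagLegalSeparation
import Summits.ResolutionOfSingularities.ResolutionOfSingularities.Theorems.FrobeniusClosingPatchingRelPerfectDepthFlagSeqState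
import Summits.ResolutionOfSingularities.ResolutionOfSingularities.Theorems.FrobeniusClosingPatchingRelPerfectDepthFlagSepCompositions
import Summits.ResolutionOfSingularities.ResolutionOfSingularities.Theorems.FrobeniusClosingPatchingRelPerfectDepthLegalCJS
import Literature.AlgebraicGeometry.Resolution.CartierDivisorReduced
import HarnessLib

/-!
# Chain W5.2 — «F6» stage 1, the residual `LegalScopedDivisorReduction₃`: PROVED composition of the phase targets
# (phase 3 discharged BY NAME, phase 1 closed modulo the OURS binder `SingCentres₃` ⇒ residual = ⟨`SingCentres₃`, `LegalPhaseTwo₃`⟩)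

[OURS · L1 W5.2 · res-L1-w52-idea-1 gen 7 (OWNER RULING O1 2026-08-27T11:55:07Z; res-L1-w52-plan-1 RULING R3c) · targets
`…DepthFlagLegalPhases`, residual `…DepthFlagLegalTargets` (p529765)]  Pure PROOFS, no definitions, FACT-FREE.  NOT statements of
the manuscript under review (Hironaka 2017); AI-written, AI review weaker than expert review.

BY NAME from the tree: res-D-pv-016's one-ideal currency `IsFlagSeq.of_isPureWeightedSeq` / `endFlag_self_iff`
(`…DepthFlagDiagonal`, p529430) and res-L1-w52-lead-1's `DepthLegal.legalSeparation₃` (`…DepthFlagLegalSeparation`, p529695, over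
res-D-pv-054's `weightedCleanupSNC_holds 2`), and res-type-049's phase-1 transport `WeightTwoB.legalPhaseOne_of_truncated`
(`…DepthLegalCJS`, over res-D-pv-054's `StateIn` machine).

RESULTS.  `isReduced_subscheme_of_flagScope` (the scope of `LegalScopedDivisorReduction₃` = res-type-049's `hred`) ·
`flagState₃_of_isPureWeightedSeq` · **`legalSeparationPure₃_holds : LegalSeparationPure₃`** ·
`legalSeparation₃_of_pure` · **`legalSeparation₃_holds : LegalSeparation₃`** · `legalScopedDivisorReduction₃_of_phases :
LegalPhaseOne₃ → LegalPhaseTwo₃ → LegalSeparation₃ → LegalScopedDivisorReduction₃` · **`legalScopedDivisorReduction₃_of_phaseOne_of_phaseTwo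
: LegalPhaseOne₃ → LegalPhaseTwo₃ → LegalScopedDivisorReduction₃`** · **`legalPhaseOne₃_of_singCentres₃ : SingCentres₃ →
LegalPhaseOne₃`** · **`legalScopedDivisorReduction₃_of_singCentres₃_of_phaseTwo : SingCentres₃ → LegalPhaseTwo₃ →
LegalScopedDivisorReduction₃`**.  With `…DepthFlagLegalGlue`
(`stageOneFlagScoped₃_of_cascade_of_cjsB_of_scoped`): T6-E1b `StageOneFlagScoped₃` from ⟨`Cascade₂`, F-32bR, `SingCentres₃`,
`LegalPhaseTwo₃`⟩.

## References
* J. Kollár, *Lectures on Resolution of Singularities* (2007), (3.111) Step 3. [Kollar2007]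
* E. Bierstone, D. Grigoriev, P. Milman, J. Włodarczyk (2011), §3.2 Lemma 3.2.1. [BierstoneGrigorievMilmanWlodarczyk2011]
-/

-- `Summit.<Summit>.<Sub>.Theorems` with `Sub = Summit` (single-conjunct summit, D-0017)
set_option linter.dupNamespace false

noncomputable section

open CategoryTheory CategoryTheory.Limits AlgebraicGeometry TopologicalSpace
open Literature.AlgebraicGeometry.Resolution
open Scheme.IdealSheafData

namespace Summit.ResolutionOfSingularities.ResolutionOfSingularities.Theorems.DepthTargets

universe u

/-- `K² ≤ K` for ideal sheaves. [folklore] -/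
private theorem sq_le_self₃ {Y : Scheme.{u}} (K : Y.IdealSheafData) : K ^ 2 ≤ K := by
  have h : K * K ≤ K * 1 :=
    mul_le_mul_of_nonneg_left (by rw [Scheme.IdealSheafData.one_eq_top]; exact le_top) (by simp)
  rw [sq]; simpa using h

/-- [OURS · L1 W5.2] **The scope is reducedness**: on a regular scheme a non-zero locally principal `H` with `FlagScope H H`
(order `≥ 2` only in codimension `≥ 2`) cuts out a REDUCED subscheme — the hypothesis `hred` of res-type-049's
`WeightTwoB.legalPhaseOne_of_truncated`.  PROVED (`isReduced_subscheme_iff_forall_idealOrder_eq_one`).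
[cite: GortzWedhorn2020, Prop. 3.27 (1)] -/
theorem isReduced_subscheme_of_flagScope {E : Scheme.{u}} [IsIntegral E] [IsNoetherian E] (hE : Scheme.IsRegular E)
    {H : E.IdealSheafData} (hH : H ≠ ⊥) (hlp : IsLocallyPrincipal H) (hsc : FlagScope H H) :
    IsReduced H.subscheme := by
  refine (isReduced_subscheme_iff_forall_idealOrder_eq_one hE hH hlp).mpr fun ζ hζ => ?_
  obtain ⟨hmem, hcoh⟩ := hζ
  have h1 : (1 : ℕ∞) ≤ idealOrder H ζ := (one_le_idealOrder_iff H ζ).mpr hmem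
  have hlt : ¬ (2 : ℕ∞) ≤ idealOrder H ζ := by
    intro h2
    have h2' : (2 : ℕ∞) ≤ idealOrder (H ⊔ H ^ 2) ζ := by rwa [sup_eq_left.mpr (sq_le_self₃ H)]
    have := hsc ζ h2'
    rw [hcoh] at this
    exact lt_irrefl _ this
  revert h1 hlt
  generalize idealOrder H ζ = a
  intro h1 hlt
  induction a using ENat.recTopCoe with
  | top => exact absurd le_top hlt
  | coe n =>
    have h3 : 1 ≤ n := by exact_mod_cast h1
    have h4 : ¬ 2 ≤ n := fun h => hlt (by exact_mod_cast h)
    have h5 : n = 1 := by omega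
    subst h5; rfl

/-- [OURS · L1 W5.2] the threefold state rides along a pure weight-two sequence (diagonal `FlagState₃`), via
`IsFlagSeq.of_isPureWeightedSeq` + `IsFlagSeq.flagState₃`. PROVED. [folklore] -/
theorem flagState₃_of_isPureWeightedSeq {E' E : Scheme.{u}} {ρ : E' ⟶ E} {H : E.IdealSheafData}
    {H' : E'.IdealSheafData} (h : IsPureWeightedSeq 2 ρ H H') (hs : FlagState₃ E H H) : FlagState₃ E' H' H' :=
  (IsFlagSeq.of_isPureWeightedSeq h).flagState₃ hs

/-- [OURS · L1 W5.2] **PHASE 3 IN PURE CURRENCY IS A THEOREM OF THE TREE**: `LegalSeparationPure₃` from res-L1-w52-lead-1's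
`DepthLegal.legalSeparation₃` (Kollár (3.111) Step 3 = res-D-pv-054's `weightedCleanupSNC_holds 2`). PROVED.
[cite: Kollar2007, (3.111) Step 3] -/
theorem legalSeparationPure₃_holds : LegalSeparationPure₃.{u} := by
  rintro E H ⟨hint, hnoeth, hreg, hexc, hdim, hH, hlp, -⟩ hsnc
  haveI := hint; haveI := hnoeth
  obtain ⟨E', ρ, H', hseq, hint', hnoeth', hreg', hexc', hdim', hne', hlp', hord⟩ :=
    DepthLegal.legalSeparation₃ E hreg hexc hdim H hH hlp hsnc
  exact ⟨E', ρ, H', hseq, ⟨hint', hnoeth', hreg', hexc', hdim', hne', hlp', le_rfl⟩, hord⟩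

/-- [OURS · L1 W5.2] **`LegalSeparation₃` from its pure form** (conversion via `IsFlagSeq.of_isPureWeightedSeq` +
`endFlag_self_iff`). PROVED. -/
theorem legalSeparation₃_of_pure (h : LegalSeparationPure₃.{u}) : LegalSeparation₃.{u} := by
  intro E _ _ hreg hexc hdim H hH hlp hsnc
  obtain ⟨E', ρ, H', hseq, hst, hord⟩ :=
    h E H ⟨inferInstance, inferInstance, hreg, hexc, hdim, hH, hlp, le_rfl⟩ hsnc
  exact ⟨E', ρ, H', H', IsFlagSeq.of_isPureWeightedSeq hseq, hst, (endFlag_self_iff H').mpr hord⟩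

/-- [OURS · L1 W5.2] **PHASE 3 IN FLAG CURRENCY IS A THEOREM OF THE TREE.** PROVED. [cite: Kollar2007, (3.111) Step 3] -/
theorem legalSeparation₃_holds : LegalSeparation₃.{u} :=
  legalSeparation₃_of_pure legalSeparationPure₃_holds

/-- [OURS · L1 W5.2] **THE COMPOSITION: `LegalPhaseOne₃ → LegalPhaseTwo₃ → LegalSeparation₃ → LegalScopedDivisorReduction₃`.**
Phases 1 and 2 are converted to diagonal flag sequences (`IsFlagSeq.of_isPureWeightedSeq`) and concatenated with phase 3's
flag sequence (`IsFlagSeq.trans`).  PROVED. -/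
theorem legalScopedDivisorReduction₃_of_phases (h1 : LegalPhaseOne₃.{u}) (h2 : LegalPhaseTwo₃.{u})
    (h3 : LegalSeparation₃.{u}) : LegalScopedDivisorReduction₃.{u} := by
  intro E _ _ hreg hexc hdim H hH hlp hsc
  obtain ⟨E₁, hnoeth₁, ρ₁, H₁, hseq₁, hst₁, hhb⟩ :=
    h1 E H ⟨inferInstance, inferInstance, hreg, hexc, hdim, hH, hlp, le_rfl⟩ hsc
  haveI := hnoeth₁
  obtain ⟨E₂, ρ₂, H₂, hseq₂, hst₂, hsnc⟩ := h2 E₁ H₁ hst₁ hhb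
  obtain ⟨hint₂, hnoeth₂, hreg₂, hexc₂, hdim₂, hne₂, hlp₂, -⟩ := hst₂
  haveI := hint₂; haveI := hnoeth₂
  obtain ⟨E₃, ρ₃, 𝔟₃, R₃, hflag₃, hst₃, hend₃⟩ := h3 E₂ hreg₂ hexc₂ hdim₂ H₂ hne₂ hlp₂ hsnc
  refine ⟨E₃, ρ₃ ≫ ρ₂ ≫ ρ₁, 𝔟₃, R₃, ?_, hst₃, hend₃⟩
  exact (IsFlagSeq.of_isPureWeightedSeq hseq₁).trans ((IsFlagSeq.of_isPureWeightedSeq hseq₂).trans hflag₃)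

/-- [OURS · L1 W5.2] **THE RESIDUAL OF RECORD IS THE PAIR ⟨`LegalPhaseOne₃`, `LegalPhaseTwo₃`⟩**:
`LegalPhaseOne₃ → LegalPhaseTwo₃ → LegalScopedDivisorReduction₃`, phase 3 discharged by `legalSeparation₃_holds`. PROVED. -/
theorem legalScopedDivisorReduction₃_of_phaseOne_of_phaseTwo (h1 : LegalPhaseOne₃.{u}) (h2 : LegalPhaseTwo₃.{u}) :
    LegalScopedDivisorReduction₃.{u} :=
  legalScopedDivisorReduction₃_of_phases h1 h2 legalSeparation₃_holds

/-- [OURS · L1 W5.2] **PHASE 1 IS CLOSED MODULO THE OURS BINDER `SingCentres₃`** — by res-type-049's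
`WeightTwoB.legalPhaseOne_of_truncated` (pure weight-two transport along a Sing-centred sequence, `StateIn` bookkeeping), the
scope-is-reducedness bridge, the state transport, and dropping the charged list (`StateIn H D ℬ 𝒟 → StateIn H D ℬ []` field-wise).
PROVED. [cite: CossartJannsenSaito2020, Thm. 6.9 (a), Cor. 6.26] -/
theorem legalPhaseOne₃_of_singCentres₃ (hF : SingCentres₃.{u}) : LegalPhaseOne₃.{u} := by
  intro E _ H hst hsc
  obtain ⟨hint, hnoeth, hreg, hexc, hdim, hH, hlp, -⟩ := hst
  haveI := hint
  have hred : IsReduced H.subscheme := isReduced_subscheme_of_flagScope hreg hH hlp hsc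
  obtain ⟨E', hint', hnoeth', ρ, H', D', ℬ', 𝒟', hseq, S, hD'⟩ :=
    WeightTwoB.legalPhaseOne_of_truncated hreg H hH hlp hred (hF E hreg hexc hdim H hH hlp hred)
  haveI := hint'
  haveI := hnoeth'
  refine ⟨E', hnoeth', ρ, H', hseq,
    flagState₃_of_isPureWeightedSeq hseq ⟨hint, hnoeth, hreg, hexc, hdim, hH, hlp, le_rfl⟩, D', ℬ', ?_, hD'⟩
  exact ⟨S.regW, S.fac, S.hostCartier, S.hostRad, S.sncB, S.irred, S.free, fun p hp => by simp at hp,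
    fun x _ h => by obtain ⟨p, hp, -⟩ := h; simp at hp⟩

/-- [OURS · L1 W5.2] **THE RESIDUAL OF RECORD IS THE PAIR ⟨`SingCentres₃`, `LegalPhaseTwo₃`⟩**:
`SingCentres₃ → LegalPhaseTwo₃ → LegalScopedDivisorReduction₃`. PROVED. -/
theorem legalScopedDivisorReduction₃_of_singCentres₃_of_phaseTwo (hF : SingCentres₃.{u}) (h2 : LegalPhaseTwo₃.{u}) :
    LegalScopedDivisorReduction₃.{u} :=
  legalScopedDivisorReduction₃_of_phaseOne_of_phaseTwo (legalPhaseOne₃_of_singCentres₃ hF) h2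

end Summit.ResolutionOfSingularities.ResolutionOfSingularities.Theorems.DepthTargets

end
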